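import Summits.CriticalPhenomena.SAWScalingLimit.Theorems.SAWRenewalTightnessTubeLowerBoundDefs
import Literature.Probability.RandomPlanarGeometry.BDGS2012

/-!
# Crux `TubeLowerBound` (stmt-CriticalPhenomena-4730), line `lasso-repair-poly-hw` (`Sketch`): stub S4

`stub_ceiling_of_exponent` — the COUNT CEILING from an enumeration exponent.  If the square-lattice
self-avoiding walk has an enumeration exponent `γ` (`cₙ ∼ A μⁿ n^{γ-1}`, BDGS2012 (1.21), tree
`Zd.HasEnumerationExponent 2 1 γ`), then the critical masses `aₙ := cₙ x_cⁿ` (`x_c = μ⁻¹`) satisfy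
`aₙ ≤ (n+1)^C` for all `n` and one `C ≥ 0` — the input S1 (polynomial Hammersley–Welsh in mass form) of the
skeleton `Cruxes/TubeLowerBound/Lines/Sketch.lean`.  Proof: eventually `cₙ ≤ 2A μⁿ n^{γ-1}`, so
`aₙ ≤ 2A (n+1)^{max(γ-1,0)}`; the finitely many earlier `aₙ` are bounded by their sum `S`; and the constant
`K = 2A + S` is absorbed into the exponent since `(n+1)^{2K} ≥ 2^{2K} ≥ 1 + 2K log 2 ≥ K` for `n ≥ 1`
(`a₀ = 1` separately).
-/

noncomputable section

namespace Summit.CriticalPhenomena.SAWScalingLimit.Theorems.TubeLowerBound.LassoRepair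

open scoped BigOperators Classical
open Filter Topology
open Literature.Probability.LatticeModels
open Literature.Probability.RandomPlanarGeometry Literature.Probability.RandomPlanarGeometry.SAW

/-- `aₙ = cₙ x_cⁿ = cₙ / μⁿ` (`x_c = μ⁻¹`, `Zd.connectiveConstant 2 = SAW.connectiveConstant`). -/
theorem weightedCount_eq_div (n : ℕ) :
    (Zd.count 2 n : ℝ) * criticalFugacity ^ n = (Zd.count 2 n : ℝ) / Zd.connectiveConstant 2 ^ n := by
  rw [show criticalFugacity = (Zd.connectiveConstant 2)⁻¹ from rfl, inv_pow, div_eq_mul_inv]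

/-- A real constant is absorbed into a power of the base `n + 1 ≥ 2`: `K ≤ (n+1)^{2K}` for `K ≥ 0`, `n ≥ 1`
(`(n+1)^{2K} ≥ 2^{2K} = e^{2K log 2} ≥ 1 + 2K log 2 ≥ K`, `log 2 > 1/2`). -/
theorem const_le_rpow_succ {K : ℝ} (hK : 0 ≤ K) {n : ℕ} (hn : 1 ≤ n) : K ≤ ((n : ℝ) + 1) ^ (2 * K) := by
  have h2 : (2 : ℝ) ≤ (n : ℝ) + 1 := by
    have : (1 : ℝ) ≤ n := by exact_mod_cast hn
    linarith
  have hlog : (1 : ℝ) / 2 ≤ Real.log 2 := le_of_lt (lt_trans (by norm_num) Real.log_two_gt_d9)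
  calc K ≤ 2 * K * Real.log 2 := by nlinarith
    _ ≤ 2 * K * Real.log 2 + 1 := by linarith
    _ ≤ Real.exp (2 * K * Real.log 2) := Real.add_one_le_exp _
    _ = (2 : ℝ) ^ (2 * K) := by
        rw [Real.rpow_def_of_pos (by norm_num : (0 : ℝ) < 2), mul_comm (Real.log 2)]
    _ ≤ ((n : ℝ) + 1) ^ (2 * K) := Real.rpow_le_rpow (by norm_num) h2 (by linarith)

/-- **S4 `stub_ceiling_of_exponent`.**  An enumeration exponent `γ` for the strictly self-avoiding walk on `ℤ²`
(`cₙ ∼ A μⁿ n^{γ-1}`) gives the polynomial count ceiling in mass form: `cₙ x_cⁿ ≤ (n+1)^C` for every `n`, for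
one `C ≥ 0`. -/
theorem stub_ceiling_of_exponent :
    (∃ γ : ℝ, Zd.HasEnumerationExponent 2 1 γ) →
    ∃ C : ℝ, 0 ≤ C ∧ ∀ n : ℕ, (Zd.count 2 n : ℝ) * criticalFugacity ^ n ≤ ((n : ℝ) + 1) ^ C := by
  rintro ⟨γ, hγ⟩
  obtain ⟨A, hA, hlim⟩ := (Zd.hasEnumerationExponent_one_iff 2 γ).1 hγ
  have hμ : 0 < Zd.connectiveConstant 2 := Zd.connectiveConstant_pos 2
  -- eventually the ratio `cₙ / (A μⁿ n^{γ-1})` is below `2`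
  obtain ⟨N₀, hN₀⟩ := eventually_atTop.1 (hlim.eventually_lt_const one_lt_two)
  set N₁ : ℕ := max N₀ 1 with hN₁
  set D : ℝ := max (γ - 1) 0 with hD
  have hD0 : 0 ≤ D := le_max_right _ _
  -- the sum of the first `N₁` masses bounds each of them
  set S : ℝ := ∑ k ∈ Finset.range N₁, (Zd.count 2 k : ℝ) * criticalFugacity ^ k with hS
  have hterm : ∀ k : ℕ, 0 ≤ (Zd.count 2 k : ℝ) * criticalFugacity ^ k := fun k =>
    mul_nonneg (Nat.cast_nonneg _) (pow_nonneg criticalFugacity_pos.le _)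
  have hS0 : 0 ≤ S := Finset.sum_nonneg fun k _ => hterm k
  set K : ℝ := 2 * A + S with hK
  have hK0 : 0 ≤ K := by positivity
  -- uniform bound `aₙ ≤ K (n+1)^D`
  have hunif : ∀ n : ℕ, (Zd.count 2 n : ℝ) * criticalFugacity ^ n ≤ K * ((n : ℝ) + 1) ^ D := by
    intro n
    have hbase : (1 : ℝ) ≤ (n : ℝ) + 1 := by
      have : (0 : ℝ) ≤ n := Nat.cast_nonneg n
      linarith
    have hpow1 : (1 : ℝ) ≤ ((n : ℝ) + 1) ^ D := Real.one_le_rpow hbase hD0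
    rcases lt_or_ge n N₁ with hn | hn
    · -- small `n`: bounded by the sum `S ≤ K`
      calc (Zd.count 2 n : ℝ) * criticalFugacity ^ n ≤ S :=
            Finset.single_le_sum (f := fun k => (Zd.count 2 k : ℝ) * criticalFugacity ^ k)
              (fun k _ => hterm k) (Finset.mem_range.2 hn)
        _ ≤ K := by rw [hK]; linarith
        _ = K * 1 := (mul_one K).symm
        _ ≤ K * ((n : ℝ) + 1) ^ D := mul_le_mul_of_nonneg_left hpow1 hK0
    · -- large `n`: `cₙ ≤ 2 A μⁿ n^{γ-1}` and `n^{γ-1} ≤ (n+1)^D`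
      have hnN₀ : N₀ ≤ n := le_trans (le_max_left _ _) hn
      have hn1 : 1 ≤ n := le_trans (le_max_right _ _) hn
      have hn1' : (1 : ℝ) ≤ n := by exact_mod_cast hn1
      have hnpos : (0 : ℝ) < n := by linarith
      have hden : 0 < A * Zd.connectiveConstant 2 ^ n * (n : ℝ) ^ (γ - 1) :=
        mul_pos (mul_pos hA (pow_pos hμ n)) (Real.rpow_pos_of_pos hnpos _)
      have hratio := hN₀ n hnN₀
      rw [div_lt_iff₀ hden] at hratio
      have hrpow : (n : ℝ) ^ (γ - 1) ≤ ((n : ℝ) + 1) ^ D :=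
        calc (n : ℝ) ^ (γ - 1) ≤ (n : ℝ) ^ D := Real.rpow_le_rpow_of_exponent_le hn1' (le_max_left _ _)
          _ ≤ ((n : ℝ) + 1) ^ D := Real.rpow_le_rpow hnpos.le (by linarith) hD0
      have hμn : 0 < Zd.connectiveConstant 2 ^ n := pow_pos hμ n
      rw [weightedCount_eq_div, div_le_iff₀ hμn]
      calc (Zd.count 2 n : ℝ) ≤ 2 * (A * Zd.connectiveConstant 2 ^ n * (n : ℝ) ^ (γ - 1)) := hratio.le
        _ = (2 * A) * (n : ℝ) ^ (γ - 1) * Zd.connectiveConstant 2 ^ n := by ring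
        _ ≤ K * ((n : ℝ) + 1) ^ D * Zd.connectiveConstant 2 ^ n := by
            refine mul_le_mul_of_nonneg_right ?_ hμn.le
            exact mul_le_mul (by rw [hK]; linarith) hrpow (Real.rpow_nonneg hnpos.le _) hK0
  refine ⟨D + 2 * K, by positivity, fun n => ?_⟩
  rcases Nat.eq_zero_or_pos n with rfl | hn
  · -- `a₀ = 1`
    simp [Zd.count_zero]
  · have hbase : (0 : ℝ) < (n : ℝ) + 1 := by positivity
    calc (Zd.count 2 n : ℝ) * criticalFugacity ^ n ≤ K * ((n : ℝ) + 1) ^ D := hunif n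
      _ ≤ ((n : ℝ) + 1) ^ (2 * K) * ((n : ℝ) + 1) ^ D :=
          mul_le_mul_of_nonneg_right (const_le_rpow_succ hK0 hn) (Real.rpow_nonneg hbase.le _)
      _ = ((n : ℝ) + 1) ^ (D + 2 * K) := by rw [← Real.rpow_add hbase, add_comm D]

end Summit.CriticalPhenomena.SAWScalingLimit.Theorems.TubeLowerBound.LassoRepair

end
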